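import Mathlib.Analysis.MeanInequalities
import Mathlib.Analysis.SpecialFunctions.Pow.NNReal
import Mathlib.Algebra.Order.BigOperators.Ring.Finset
import Mathlib.Algebra.BigOperators.Group.Finset.Powerset
import Mathlib.Logic.Function.DependsOn
import Mathlib.Logic.Equiv.Prod
import Mathlib.Data.Finset.Interval
import Mathlib.Algebra.BigOperators.Expect
import Mathlib.Algebra.Order.BigOperators.Expect
import Mathlib.Topology.Algebra.Monoid
import Mathlib.Topology.Order.OrderClosed
import HarnessLib

/-!
# Gowers box norms and the Gowers–Cauchy–Schwarz inequalities (Green–Tao 2010, App. B)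

Trunk T-SIEVE (`Literature/NumberTheory/Sieve`). Part of the decomposition of
`Literature.NumberTheory.Sieve.GreenTaoZiegler2012_finiteComplexity` (see `LinearEquationsInPrimesTransference.lean`):
the "elementary" Gowers-norm theory of B. Green, T. Tao, *Linear equations in primes*, Ann. of
Math. 171 (2010), Appendix B, on which the proof of the generalised von Neumann theorem
(Prop. 7.1, App. C; the named fact `Literature.NumberTheory.Sieve.GreenTao2010_generalisedVonNeumann` of
`LinearEquationsInPrimesPseudorandom.lean`) rests. Everything in this file is proved:

* complements to Mathlib's `Finset.expect` (`𝔼 y, F y`, the trunk convention for averages):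
  Fubini over products of finite types, re-randomisation of one coordinate
  (`Literature.NumberTheory.Sieve.expect_update`) and the equal-exponent Hölder inequality
  `𝔼 ∏_{i ∈ S} βᵢ^{1/|S|} ≤ ∏ (𝔼 βᵢ)^{1/|S|}` (`Literature.NumberTheory.Sieve.expect_prod_rpow_le`, from Mathlib's weighted
  AM–GM inequality);
* `Literature.NumberTheory.Sieve.mixPt`, `Literature.NumberTheory.Sieve.boxProd`, `Literature.NumberTheory.Sieve.boxPower` — the mixed points `x^{(ω)}`, box products
  `∏_{ω ∈ {0,1}^A} f_ω(x^{(ω)})` and the `2^{|A|}`-th powers `‖f‖_{□^A}^{2^{|A|}}` of the Gowers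
  box norms (Def. B.1), the recursive identity following Def. B.1 (`Literature.NumberTheory.Sieve.boxPower_insert`) and non-negativity
  (`Literature.NumberTheory.Sieve.boxPower_nonneg`);
* `Literature.NumberTheory.Sieve.gowersCauchySchwarz` — the Gowers–Cauchy–Schwarz inequality, Lemma B.2, by the printed
  induction on `|A|` (one Cauchy–Schwarz, the induction hypothesis, Hölder);
* `Literature.NumberTheory.Sieve.expect_prod_eq_expect_boxProd` — products of lower-order functions as box products (the
  observation proving Cor. B.3);
* `Literature.NumberTheory.Sieve.wBoxPower`, `Literature.NumberTheory.Sieve.weightedGvN` — the weighted box norms `‖·‖_{□^B(ν)}` and the weighted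
  generalised von Neumann inequality, Cor. B.4, by the printed refactorisation
  `f̃_B = f_B ν_B^{-1} ∏_{C ⊆ B} ν_C^{2^{-(|A|-|C|)}}` for strictly positive weights
  (`Literature.NumberTheory.Sieve.weightedGvN_of_pos`) and a limiting argument.

## Rendering

* Functions are real-valued (the application in App. C is to real functions), so the
  conjugations `𝒞^{|ω|}` of Def. B.1 disappear, and all inequalities are stated in the
  `2^{|A|}`-th power form `|𝔼 ∏_ω f_ω(x^{(ω)})|^{2^{|A|}} ≤ ∏_ω ‖f_ω‖^{2^{|A|}}_{□^A}`, which avoids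
  roots (a root form is `Literature.NumberTheory.Sieve.gowersCauchySchwarz_rpow`).
* Points are `x : ι → X` for one finite coordinate type `X` (all `X_α` equal, as in App. C where
  `X_α = ℤ_{N'}`); the doubled coordinates form a finite set `A : Finset ι`, a vertex
  `ω ∈ {0,1}^A` is the finite set `{α : ω_α = 1} ⊆ A`, and `x^{(ω)}` (`Literature.NumberTheory.Sieve.mixPt`) reads the
  coordinates in `ω` off `x⁽¹⁾` and all others off `x⁽⁰⁾`. Coordinates outside `A` are thus
  *undoubled parameters* (the variables `y` of App. C), and every average is also taken over
  them; with this convention Lemma B.2 holds verbatim for `A ≠ ∅` (for `A = ∅` the printed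
  convention `‖f‖_{□(X_∅)} := f` makes (B.5) an identity between complex numbers, which has no
  real power form), and Cor. B.4 holds for functions `f_B` depending on the coordinates in `B`
  and on the undoubled ones (`DependsOn (f B) (↑B ∪ (↑A)ᶜ)`).

## References

* B. Green, T. Tao, *Linear equations in primes*, Ann. of Math. (2) 171 (2010), 1753–1850
  (arXiv:math/0606088), Appendix B: Def. B.1 (Gowers box norms) and the recursive identity
  following it, Lemma B.2 (Gowers–Cauchy–Schwarz inequality), Cor. B.3 (second
  Gowers–Cauchy–Schwarz inequality), Cor. B.4 (weighted generalised von Neumann theorem).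
-/

noncomputable section

open Finset
open scoped BigOperators

namespace Literature.NumberTheory.Sieve

/-! ### Averages over finite types: complements to Mathlib's `Finset.expect` -/

section expect

variable {Y : Type*} [Fintype Y] {Y' : Type*} [Fintype Y']

/-- Reindexing an average along a bijection. [folklore] -/
theorem expect_comp_equiv (e : Y ≃ Y') (F : Y' → ℝ) : 𝔼 y, F (e y) = 𝔼 y', F y' :=
  Fintype.expect_equiv e _ _ fun _ => rfl

/-- Fubini for averages over a product of finite types. [folklore] -/
theorem expect_prod_eq (F : Y × Y' → ℝ) : 𝔼 p, F p = 𝔼 y, 𝔼 y', F (y, y') := by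
  rw [← Finset.expect_product, Finset.univ_product_univ]

/-- Fubini for averages over a product of finite types, the other order. [folklore] -/
theorem expect_prod_eq' (F : Y × Y' → ℝ) : 𝔼 p, F p = 𝔼 y', 𝔼 y, F (y, y') := by
  rw [expect_prod_eq, Finset.expect_comm]

/-- Fubini: an iterated average is an average over the product. [folklore] -/
theorem expect_expect_eq_expect_prod (G : Y → Y' → ℝ) :
    𝔼 y, 𝔼 y', G y y' = 𝔼 p : Y × Y', G p.1 p.2 :=
  (expect_prod_eq fun p : Y × Y' => G p.1 p.2).symm

/-- The average of a function of the first coordinate. [folklore] -/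
theorem expect_prod_fst [Nonempty Y'] (F : Y → ℝ) : 𝔼 p : Y × Y', F p.1 = 𝔼 y, F y := by
  rw [expect_prod_eq]
  simp_rw [Fintype.expect_const]

/-- The average of a function of the second coordinate. [folklore] -/
theorem expect_prod_snd [Nonempty Y] (F : Y' → ℝ) : 𝔼 p : Y × Y', F p.2 = 𝔼 y', F y' := by
  rw [expect_prod_eq']
  simp_rw [Fintype.expect_const]

/-- Independence: `𝔼_{(y,y')} F(y) G(y') = 𝔼 F · 𝔼 G`. [folklore] -/
theorem expect_prod_mul (F : Y → ℝ) (G : Y' → ℝ) :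
    𝔼 p : Y × Y', F p.1 * G p.2 = (𝔼 y, F y) * 𝔼 y', G y' := by
  rw [Fintype.expect_mul_expect, expect_prod_eq]

/-- **Hölder's inequality with equal exponents** (from the AM–GM inequality): for `m = #S ≥ 1`
non-negative functions `β_i`, `𝔼_y ∏_{i ∈ S} β_i(y)^{1/m} ≤ ∏_{i ∈ S} (𝔼 β_i)^{1/m}`.
[folklore] -/
theorem expect_prod_rpow_le [Nonempty Y] {κ : Type*} (S : Finset κ) (hS : S.Nonempty)
    (β : κ → Y → ℝ) (hβ : ∀ i ∈ S, ∀ y, 0 ≤ β i y) :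
    𝔼 y, ∏ i ∈ S, β i y ^ (1 / (S.card : ℝ)) ≤ ∏ i ∈ S, (𝔼 y, β i y) ^ (1 / (S.card : ℝ)) := by
  set m : ℝ := (S.card : ℝ) with hm
  have hm0 : 0 < m := by rw [hm]; exact_mod_cast hS.card_pos
  have hexp : (1 / m) ≠ 0 := by positivity
  have hc : ∀ i ∈ S, 0 ≤ 𝔼 y, β i y := fun i hi => Finset.expect_nonneg fun y _ => hβ i hi y
  by_cases hzero : ∃ i ∈ S, 𝔼 y, β i y = 0
  · -- some `β i` vanishes identically: both sides are `0`
    obtain ⟨i, hi, h0⟩ := hzero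
    have hβ0 : ∀ y, β i y = 0 := fun y =>
      congr_fun ((Fintype.expect_eq_zero_iff_of_nonneg fun y => hβ i hi y).mp h0) y
    have hl : 𝔼 y, ∏ j ∈ S, β j y ^ (1 / m) = 0 := by
      have : (fun y => ∏ j ∈ S, β j y ^ (1 / m)) = fun _ => 0 := by
        funext y
        exact Finset.prod_eq_zero hi (by rw [hβ0 y, Real.zero_rpow hexp])
      rw [this, Fintype.expect_const]
    have hr : ∏ j ∈ S, (𝔼 y, β j y) ^ (1 / m) = 0 :=
      Finset.prod_eq_zero hi (by rw [h0, Real.zero_rpow hexp])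
    rw [hl, hr]
  · push Not at hzero
    have hcpos : ∀ i ∈ S, 0 < 𝔼 y, β i y := fun i hi => lt_of_le_of_ne (hc i hi) (hzero i hi).symm
    -- AM–GM pointwise for `z_i = β_i(y) / 𝔼 β_i` with weights `1/m`
    have hpt : ∀ y, ∏ i ∈ S, (β i y / 𝔼 y', β i y') ^ (1 / m) ≤
        ∑ i ∈ S, (1 / m) * (β i y / 𝔼 y', β i y') := by
      intro y
      refine Real.geom_mean_le_arith_mean_weighted S (fun _ => 1 / m)
        (fun i => β i y / 𝔼 y', β i y') (fun _ _ => by positivity) ?_ fun i hi =>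
          div_nonneg (hβ i hi y) (hc i hi)
      rw [Finset.sum_const, nsmul_eq_mul, ← hm, mul_one_div_cancel hm0.ne']
    -- average the pointwise bound
    have havg : 𝔼 y, ∏ i ∈ S, (β i y / 𝔼 y', β i y') ^ (1 / m) ≤ 1 := by
      refine (Finset.expect_le_expect fun y _ => hpt y).trans ?_
      rw [Finset.expect_sum_comm]
      simp_rw [← Finset.mul_expect]
      have : ∀ i ∈ S, (1 / m) * 𝔼 y, β i y / 𝔼 y', β i y' = 1 / m := by
        intro i hi
        have h1 : 𝔼 y, β i y / 𝔼 y', β i y' = 1 := by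
          simp_rw [div_eq_mul_inv]
          rw [← Finset.expect_mul, mul_inv_cancel₀ (hcpos i hi).ne']
        rw [h1, mul_one]
      rw [Finset.sum_congr rfl this, Finset.sum_const, nsmul_eq_mul, ← hm,
        mul_one_div_cancel hm0.ne']
    -- split off the constants `(𝔼 β_i)^{-1/m}`
    have hsplit : ∀ y, ∏ i ∈ S, (β i y / 𝔼 y', β i y') ^ (1 / m) =
        (∏ i ∈ S, β i y ^ (1 / m)) * (∏ i ∈ S, (𝔼 y', β i y') ^ (1 / m))⁻¹ := by
      intro y
      rw [← Finset.prod_inv_distrib, ← Finset.prod_mul_distrib]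
      refine Finset.prod_congr rfl fun i hi => ?_
      rw [Real.div_rpow (hβ i hi y) (hc i hi), div_eq_mul_inv]
    simp_rw [hsplit] at havg
    rw [← Finset.expect_mul] at havg
    have hPpos : 0 < ∏ i ∈ S, (𝔼 y, β i y) ^ (1 / m) :=
      Finset.prod_pos fun i hi => Real.rpow_pos_of_pos (hcpos i hi) _
    calc 𝔼 y, ∏ i ∈ S, β i y ^ (1 / m)
        = (𝔼 y, ∏ i ∈ S, β i y ^ (1 / m)) * (∏ i ∈ S, (𝔼 y, β i y) ^ (1 / m))⁻¹ *
            ∏ i ∈ S, (𝔼 y, β i y) ^ (1 / m) := by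
          rw [mul_assoc, inv_mul_cancel₀ hPpos.ne', mul_one]
      _ ≤ 1 * ∏ i ∈ S, (𝔼 y, β i y) ^ (1 / m) := by gcongr
      _ = _ := one_mul _

end expect

/-! ### Re-randomising one coordinate -/

section update

variable {ι : Type*} [Fintype ι] [DecidableEq ι] {X : Type*} [Fintype X] [Nonempty X]

/-- Re-randomising one coordinate of a uniformly distributed point does not change averages:
`𝔼_x F(x) = 𝔼_{x,u} F(x with x_α := u)`. [folklore] -/
theorem expect_update (α : ι) (F : (ι → X) → ℝ) :
    (𝔼 q : (ι → X) × X, F (Function.update q.1 α q.2)) = (𝔼 y, F y) := by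
  -- `(x, u) ↦ (x|_{α:=u}, x_α)` is an involution of `X^ι × X`
  let Φ : ((ι → X) × X) ≃ ((ι → X) × X) :=
    Function.Involutive.toPerm (fun q => (Function.update q.1 α q.2, q.1 α)) fun q => by
      ext1
      · simp only [Function.update_idem, Function.update_eq_self]
      · simp only [Function.update_self]
  have h := expect_comp_equiv Φ (fun q : (ι → X) × X => F q.1)
  rw [expect_prod_fst] at h
  exact h

/-- Iterated form: `𝔼_x 𝔼_u F(x|_{α:=u}) = 𝔼_x F(x)`. [folklore] -/
theorem expect_expect_update (α : ι) (F : (ι → X) → ℝ) :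
    (𝔼 x : ι → X, 𝔼 u : X, F (Function.update x α u)) = (𝔼 y, F y) := by
  rw [expect_expect_eq_expect_prod (fun (x : ι → X) (u : X) => F (Function.update x α u))]
  exact expect_update α F

/-- Re-randomising the `α`-coordinates of both points of a pair:
`𝔼_{x₀,x₁} G(x₀, x₁) = 𝔼_{x₀,x₁,u,v} G(x₀|_{α:=u}, x₁|_{α:=v})`. [folklore] -/
theorem expect_update_pair (α : ι) (G : (ι → X) → (ι → X) → ℝ) :
    (𝔼 q : ((ι → X) × (ι → X)) × (X × X), G (Function.update q.1.1 α q.2.1) (Function.update q.1.2 α q.2.2)) =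
      (𝔼 p : (ι → X) × (ι → X), G p.1 p.2) := by
  calc (𝔼 q : ((ι → X) × (ι → X)) × (X × X), G (Function.update q.1.1 α q.2.1) (Function.update q.1.2 α q.2.2))
      = (𝔼 p : (ι → X) × (ι → X), 𝔼 w : X × X, G (Function.update p.1 α w.1) (Function.update p.2 α w.2)) := expect_prod_eq _
    _ = (𝔼 x₀ : ι → X, 𝔼 x₁ : ι → X, 𝔼 u : X, 𝔼 v : X, G (Function.update x₀ α u) (Function.update x₁ α v)) := by
        rw [expect_prod_eq]
        congr 1; funext x₀; congr 1; funext x₁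
        exact expect_prod_eq _
    _ = (𝔼 x₀ : ι → X, 𝔼 u : X, 𝔼 x₁ : ι → X, 𝔼 v : X, G (Function.update x₀ α u) (Function.update x₁ α v)) := by
        congr 1; funext x₀
        exact Finset.expect_comm _ _ _
    _ = (𝔼 x₀ : ι → X, 𝔼 u : X, 𝔼 x₁ : ι → X, G (Function.update x₀ α u) x₁) := by
        congr 1; funext x₀; congr 1; funext u
        exact expect_expect_update α (G (Function.update x₀ α u))
    _ = (𝔼 x₀ : ι → X, 𝔼 x₁ : ι → X, 𝔼 u : X, G (Function.update x₀ α u) x₁) := by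
        congr 1; funext x₀
        exact Finset.expect_comm _ _ _
    _ = (𝔼 x₁ : ι → X, 𝔼 x₀ : ι → X, 𝔼 u : X, G (Function.update x₀ α u) x₁) := Finset.expect_comm _ _ _
    _ = (𝔼 x₁ : ι → X, 𝔼 x₀ : ι → X, G x₀ x₁) := by
        congr 1; funext x₁
        exact expect_expect_update α (fun x₀ => G x₀ x₁)
    _ = (𝔼 x₀ : ι → X, 𝔼 x₁ : ι → X, G x₀ x₁) := Finset.expect_comm _ _ _
    _ = (𝔼 p : (ι → X) × (ι → X), G p.1 p.2) := expect_expect_eq_expect_prod _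

end update

/-! ### Mixed points and box products (Green–Tao 2010, Def. B.1) -/

section box

variable {ι : Type*} [DecidableEq ι] {X : Type*}

/-- The mixed point `x^{(ω)}` of a pair `(x⁽⁰⁾, x⁽¹⁾)`: coordinates in `ω` are taken from
`x⁽¹⁾`, all others from `x⁽⁰⁾` (`ω ⊆ A` encodes `{0,1}^A`; coordinates outside the doubled set `A`
are always read off `x⁽⁰⁾`, so they serve as undoubled parameters).
[cite: GreenTao2010, App. B, Def. B.1] -/
def mixPt (x₀ x₁ : ι → X) (ω : Finset ι) : ι → X :=
  fun a => if a ∈ ω then x₁ a else x₀ a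

/-- `x^{(∅)} = x⁽⁰⁾`. [folklore] -/
@[simp] theorem mixPt_empty (x₀ x₁ : ι → X) : mixPt x₀ x₁ ∅ = x₀ := by
  funext a; simp [mixPt]

/-- Coordinates of a mixed point inside `ω`. [folklore] -/
theorem mixPt_of_mem {x₀ x₁ : ι → X} {ω : Finset ι} {a : ι} (h : a ∈ ω) :
    mixPt x₀ x₁ ω a = x₁ a := by simp [mixPt, h]

/-- Coordinates of a mixed point outside `ω`. [folklore] -/
theorem mixPt_of_not_mem {x₀ x₁ : ι → X} {ω : Finset ι} {a : ι} (h : a ∉ ω) :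
    mixPt x₀ x₁ ω a = x₀ a := by simp [mixPt, h]

/-- Adding a coordinate to `ω` updates that coordinate from `x⁽¹⁾`. [folklore] -/
theorem mixPt_insert (x₀ x₁ : ι → X) (ω : Finset ι) (α : ι) :
    mixPt x₀ x₁ (insert α ω) = Function.update (mixPt x₀ x₁ ω) α (x₁ α) := by
  funext a
  by_cases h : a = α
  · subst h; simp [mixPt]
  · rw [Function.update_of_ne h]
    simp [mixPt, h]

/-- Mixed points of updated pairs, `α ∉ ω`: the new `α`-coordinate comes from `x⁽⁰⁾`.
[folklore] -/
theorem mixPt_update_of_not_mem {x₀ x₁ : ι → X} {ω : Finset ι} {α : ι} (h : α ∉ ω)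
    (u v : X) : mixPt (Function.update x₀ α u) (Function.update x₁ α v) ω =
      Function.update (mixPt x₀ x₁ ω) α u := by
  funext a
  by_cases ha : a = α
  · subst ha; simp [mixPt, h]
  · simp [mixPt, Function.update_of_ne ha]

/-- Mixed points of updated pairs, `α ∈ ω` via `insert`: the new `α`-coordinate comes from
`x⁽¹⁾`. [folklore] -/
theorem mixPt_update_insert {x₀ x₁ : ι → X} {ω : Finset ι} {α : ι} (h : α ∉ ω) (u v : X) :
    mixPt (Function.update x₀ α u) (Function.update x₁ α v) (insert α ω) =
      Function.update (mixPt x₀ x₁ ω) α v := by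
  rw [mixPt_insert, mixPt_update_of_not_mem h, Function.update_idem]
  simp

/-- Two mixed points agree at the coordinates where their index sets agree. [folklore] -/
theorem mixPt_inter_eq_of_mem {x₀ x₁ : ι → X} {ω C : Finset ι} {a : ι} (ha : a ∈ C) :
    mixPt x₀ x₁ (ω ∩ C) a = mixPt x₀ x₁ ω a := by
  by_cases h : a ∈ ω
  · rw [mixPt_of_mem h, mixPt_of_mem (Finset.mem_inter.mpr ⟨h, ha⟩)]
  · rw [mixPt_of_not_mem h, mixPt_of_not_mem (fun h' => h (Finset.mem_inter.mp h').1)]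

variable [Fintype ι] [Fintype X]

/-- The box product `∏_{ω ⊆ A} f_ω(x^{(ω)})` of a family of functions indexed by the vertices
`ω ∈ {0,1}^A` of the cube. [cite: GreenTao2010, App. B, Def. B.1 and Lemma B.2] -/
def boxProd (A : Finset ι) (f : Finset ι → (ι → X) → ℝ) (p : (ι → X) × (ι → X)) : ℝ :=
  ∏ ω ∈ A.powerset, f ω (mixPt p.1 p.2 ω)

/-- The `2^{|A|}`-th power of the Gowers box norm, `‖g‖_{□^A}^{2^{|A|}} = 𝔼 ∏_{ω ⊆ A} g(x^{(ω)})`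
(real-valued functions; coordinates outside `A` are undoubled parameters which are averaged
as well). [cite: GreenTao2010, App. B, Def. B.1] -/
def boxPower (A : Finset ι) (g : (ι → X) → ℝ) : ℝ :=
  (𝔼 p, (boxProd A fun _ => g) p)

variable [Nonempty X]

/-- **Splitting off one coordinate**: for `α ∉ A'`,
`𝔼 ∏_{ω ⊆ A' ∪ {α}} f_ω(x^{(ω)}) = 𝔼_{x,u,v} ∏_{ω ⊆ A'} f_ω(x^{(ω)}|_{α := u}) f_{ω ∪ α}(x^{(ω)}|_{α := v})`.
[cite: GreenTao2010, App. B, proof of Lemma B.2] -/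
theorem expect_boxProd_insert {A' : Finset ι} {α : ι} (hα : α ∉ A')
    (f : Finset ι → (ι → X) → ℝ) :
    (𝔼 p, boxProd (insert α A') f p) =
      (𝔼 q : ((ι → X) × (ι → X)) × (X × X), (∏ ω ∈ A'.powerset, f ω (Function.update (mixPt q.1.1 q.1.2 ω) α q.2.1)) *
          ∏ ω ∈ A'.powerset, f (insert α ω) (Function.update (mixPt q.1.1 q.1.2 ω) α q.2.2)) := by
  have h := expect_update_pair α (fun x₀ x₁ => boxProd (insert α A') f (x₀, x₁))
  rw [← h]
  congr 1
  funext q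
  simp only [boxProd]
  rw [Finset.prod_powerset_insert hα]
  congr 1
  · refine Finset.prod_congr rfl fun ω hω => ?_
    have hαω : α ∉ ω := fun h => hα (Finset.mem_powerset.mp hω h)
    rw [mixPt_update_of_not_mem hαω]
  · refine Finset.prod_congr rfl fun ω hω => ?_
    have hαω : α ∉ ω := fun h => hα (Finset.mem_powerset.mp hω h)
    rw [mixPt_update_insert hαω]

/-- **The recursive identity** following Def. B.1:
`‖g‖_{□^{A' ∪ {α}}}^{2^{|A'|+1}} = 𝔼_{u,v} ‖g(·|_{α:=u}) g(·|_{α:=v})‖_{□^{A'}}^{2^{|A'|}}`.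
[cite: GreenTao2010, App. B (recursive identity after Def. B.1)] -/
theorem boxPower_insert {A' : Finset ι} {α : ι} (hα : α ∉ A') (g : (ι → X) → ℝ) :
    boxPower (insert α A') g =
      (𝔼 w : X × X, boxPower A'
        (fun x => g (Function.update x α w.1) * g (Function.update x α w.2))) := by
  unfold boxPower
  rw [expect_boxProd_insert hα, expect_prod_eq']
  congr 1; funext w
  congr 1; funext p
  unfold boxProd
  rw [← Finset.prod_mul_distrib]

/-- The family `g^{(u,v)}_ω(x) = f_ω(x|_{α:=u}) f_ω(x|_{α:=v})` appearing after one
Cauchy–Schwarz step. [cite: GreenTao2010, App. B, proof of Lemma B.2] -/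
def doubledFamily (f : Finset ι → (ι → X) → ℝ) (α : ι) (w : X × X) :
    Finset ι → (ι → X) → ℝ :=
  fun ω x => f ω (Function.update x α w.1) * f ω (Function.update x α w.2)

/-- One Cauchy–Schwarz step: with `F₀ = 𝔼_u ∏_{ω ⊆ A'} f_ω(x^{(ω)}|_{α:=u})` and
`F₁ = 𝔼_v ∏_{ω ⊆ A'} f_{ω∪α}(x^{(ω)}|_{α:=v})`,
`(𝔼 ∏_{ω ⊆ A} f_ω)² ≤ 𝔼 F₀² · 𝔼 F₁²`, and `𝔼 F₀² = 𝔼_{u,v} 𝔼 ∏_{ω ⊆ A'} g^{(u,v)}_ω`.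
[cite: GreenTao2010, App. B, proof of Lemma B.2] -/
theorem expect_boxProd_insert_sq_le {A' : Finset ι} {α : ι} (hα : α ∉ A')
    (f : Finset ι → (ι → X) → ℝ) :
    (𝔼 p, boxProd (insert α A') f p) ^ 2 ≤
      (𝔼 w : X × X, (𝔼 p, boxProd A' (doubledFamily f α w) p)) *
        (𝔼 w : X × X, (𝔼 p, (boxProd A' (doubledFamily (fun ω => f (insert α ω)) α w)) p)) := by
  -- the two factors
  set P : ((ι → X) × (ι → X)) → X → ℝ :=
    fun p u => ∏ ω ∈ A'.powerset, f ω (Function.update (mixPt p.1 p.2 ω) α u) with hP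
  set Q : ((ι → X) × (ι → X)) → X → ℝ :=
    fun p v => ∏ ω ∈ A'.powerset, f (insert α ω) (Function.update (mixPt p.1 p.2 ω) α v)
    with hQ
  have hsplit : (𝔼 p, boxProd (insert α A') f p) =
      (𝔼 p : (ι → X) × (ι → X), (𝔼 y, P p y) * (𝔼 y, Q p y)) := by
    rw [expect_boxProd_insert hα, expect_prod_eq]
    congr 1; funext p
    exact expect_prod_mul (P p) (Q p)
  have hsq : ∀ (R : ((ι → X) × (ι → X)) → X → ℝ),
      (𝔼 p : (ι → X) × (ι → X), (𝔼 y, R p y) ^ 2) =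
        (𝔼 w : X × X, 𝔼 p : (ι → X) × (ι → X), R p w.1 * R p w.2) := by
    intro R
    have : ∀ p : (ι → X) × (ι → X), (𝔼 y, R p y) ^ 2 =
        (𝔼 w : X × X, R p w.1 * R p w.2) := fun p => by
      rw [sq, ← expect_prod_mul]
    simp_rw [this]
    exact Finset.expect_comm Finset.univ Finset.univ (fun (p : (ι → X) × (ι → X)) (w : X × X) => R p w.1 * R p w.2)
  have hPP : ∀ (w : X × X) (p : (ι → X) × (ι → X)),
      P p w.1 * P p w.2 = boxProd A' (doubledFamily f α w) p := fun w p => by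
    simp only [hP, boxProd, doubledFamily]
    rw [← Finset.prod_mul_distrib]
  have hQQ : ∀ (w : X × X) (p : (ι → X) × (ι → X)),
      Q p w.1 * Q p w.2 = boxProd A' (doubledFamily (fun ω => f (insert α ω)) α w) p :=
    fun w p => by
    simp only [hQ, boxProd, doubledFamily]
    rw [← Finset.prod_mul_distrib]
  rw [hsplit]
  calc (𝔼 p : (ι → X) × (ι → X), (𝔼 y, P p y) * (𝔼 y, Q p y)) ^ 2
      ≤ (𝔼 p : (ι → X) × (ι → X), (𝔼 y, P p y) ^ 2) *
          (𝔼 p : (ι → X) × (ι → X), (𝔼 y, Q p y) ^ 2) := Finset.expect_mul_sq_le_sq_mul_sq _ _ _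
    _ = _ := by
        rw [hsq P, hsq Q]
        simp_rw [hPP, hQQ]

end box


section gcs

variable {ι : Type*} [DecidableEq ι] [Fintype ι] {X : Type*} [Fintype X]

/-- The box power over no coordinates is a plain average. [folklore] -/
theorem boxPower_empty (g : (ι → X) → ℝ) :
    boxPower (∅ : Finset ι) g = (𝔼 p : (ι → X) × (ι → X), g p.1) := by
  unfold boxPower boxProd
  simp

/-- `𝔼_{u,v} 𝔼 ∏_{ω ⊆ A'} g^{(u,v)}_ω(x^{(ω)}) = 𝔼_x (𝔼_u ∏_{ω ⊆ A'} f_ω(x^{(ω)}|_{α:=u}))² ≥ 0`: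
the doubled average is an average of squares. [cite: GreenTao2010, App. B, proof of Lemma B.2] -/
theorem expect_doubledFamily_eq_sq (A' : Finset ι) (α : ι) (f : Finset ι → (ι → X) → ℝ) :
    (𝔼 w : X × X, (𝔼 p, boxProd A' (doubledFamily f α w) p)) =
      (𝔼 p : (ι → X) × (ι → X), (𝔼 u : X, ∏ ω ∈ A'.powerset, f ω (Function.update (mixPt p.1 p.2 ω) α u)) ^ 2) := by
  set R : ((ι → X) × (ι → X)) → X → ℝ :=
    fun p u => ∏ ω ∈ A'.powerset, f ω (Function.update (mixPt p.1 p.2 ω) α u) with hR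
  have hRR : ∀ (w : X × X) (p : (ι → X) × (ι → X)),
      boxProd A' (doubledFamily f α w) p = R p w.1 * R p w.2 := fun w p => by
    simp only [hR, boxProd, doubledFamily]
    rw [← Finset.prod_mul_distrib]
  have h1 : ∀ p : (ι → X) × (ι → X), (𝔼 y, R p y) ^ 2 =
      (𝔼 w : X × X, R p w.1 * R p w.2) := fun p => by
    rw [sq, ← expect_prod_mul]
  show (𝔼 w : X × X, (𝔼 p, boxProd A' (doubledFamily f α w) p)) =
    (𝔼 p : (ι → X) × (ι → X), (𝔼 y, R p y) ^ 2)
  simp_rw [h1]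
  rw [Finset.expect_comm Finset.univ Finset.univ (fun (p : (ι → X) × (ι → X)) (w : X × X) => R p w.1 * R p w.2)]
  congr 1; funext w; congr 1; funext p
  exact hRR w p

/-- Non-negativity of the doubled average. [cite: GreenTao2010, App. B, proof of Lemma B.2] -/
theorem expect_doubledFamily_nonneg (A' : Finset ι) (α : ι) (f : Finset ι → (ι → X) → ℝ) :
    0 ≤ (𝔼 w : X × X, (𝔼 p, boxProd A' (doubledFamily f α w) p)) := by
  rw [expect_doubledFamily_eq_sq]
  exact Finset.expect_nonneg fun _ _ => sq_nonneg _

variable [Nonempty X]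

/-- `‖g‖_{□^A}^{2^{|A|}} ≥ 0` for `A` non-empty (it is an average of squares by the recursive identity).
[cite: GreenTao2010, App. B (after Def. B.1)] -/
theorem boxPower_nonneg {A : Finset ι} (hA : A.Nonempty) (g : (ι → X) → ℝ) :
    0 ≤ boxPower A g := by
  obtain ⟨α, hα⟩ := hA
  rw [← Finset.insert_erase hα, boxPower_insert (Finset.notMem_erase α A)]
  exact expect_doubledFamily_nonneg (A.erase α) α (fun _ => g)

/-- **The Gowers–Cauchy–Schwarz inequality** (Green–Tao 2010, Lemma B.2, real-valued, in the
`2^{|A|}`-th power form, for `A` non-empty; coordinates outside `A` are undoubled parameters,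
cf. `mixPt`): `|𝔼 ∏_{ω ⊆ A} f_ω(x^{(ω)})|^{2^{|A|}} ≤ ∏_{ω ⊆ A} ‖f_ω‖_{□^A}^{2^{|A|}}`.
[cite: GreenTao2010, App. B, Lemma B.2] -/
theorem gowersCauchySchwarz {A : Finset ι} (hA : A.Nonempty) (f : Finset ι → (ι → X) → ℝ) :
    |(𝔼 y, boxProd A f y)| ^ (2 ^ A.card) ≤ ∏ ω ∈ A.powerset, boxPower A (f ω) := by
  induction A using Finset.induction_on generalizing f with
  | empty => exact absurd hA Finset.not_nonempty_empty
  | insert α A' hα ih =>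
    -- the bound for each of the two Cauchy–Schwarz factors
    have hE : ∀ f' : Finset ι → (ι → X) → ℝ,
        (𝔼 w : X × X, (𝔼 p, boxProd A' (doubledFamily f' α w) p)) ^ (2 ^ A'.card) ≤
          ∏ ω ∈ A'.powerset, boxPower (insert α A') (f' ω) := by
      intro f'
      rcases A'.eq_empty_or_nonempty with h | h
      · subst h
        simp only [Finset.card_empty, pow_zero, pow_one, Finset.powerset_empty,
          Finset.prod_singleton]
        rw [boxPower_insert hα]
        rfl
      · -- inductive case: Gowers–Cauchy–Schwarz on `A'`, then Hölder
        set m : ℕ := 2 ^ A'.card with hm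
        have hm0 : m ≠ 0 := by positivity
        have hmcard : A'.powerset.card = m := by rw [Finset.card_powerset]
        set β : Finset ι → X × X → ℝ :=
          fun ω w => boxPower A' (doubledFamily f' α w ω) with hβ
        have hβnn : ∀ ω w, 0 ≤ β ω w := fun ω w => boxPower_nonneg h _
        -- pointwise: `Φ(w) ≤ ∏_ω β_ω(w)^{1/m}`
        have hpt : ∀ w : X × X, (𝔼 p, boxProd A' (doubledFamily f' α w) p) ≤
            ∏ ω ∈ A'.powerset, β ω w ^ (1 / (A'.powerset.card : ℝ)) := by
          intro w
          have h1 : |(𝔼 p, boxProd A' (doubledFamily f' α w) p)| ^ m ≤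
              ∏ ω ∈ A'.powerset, β ω w := ih h _
          have h2 : |(𝔼 p, boxProd A' (doubledFamily f' α w) p)| ≤
              (∏ ω ∈ A'.powerset, β ω w) ^ ((m : ℝ)⁻¹) := by
            rw [← Real.pow_rpow_inv_natCast (abs_nonneg _) hm0]
            exact Real.rpow_le_rpow (pow_nonneg (abs_nonneg _) _) h1 (by positivity)
          rw [hmcard, one_div, Real.finsetProd_rpow _ _ fun ω _ => hβnn ω w]
          exact (le_abs_self _).trans h2
        -- average and apply Hölder
        have h3 : (𝔼 w : X × X, (𝔼 p, boxProd A' (doubledFamily f' α w) p)) ≤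
            ∏ ω ∈ A'.powerset, (𝔼 y, β ω y) ^ (1 / (A'.powerset.card : ℝ)) :=
          (Finset.expect_le_expect fun w _ => hpt w).trans
            (expect_prod_rpow_le _ ⟨∅, Finset.empty_mem_powerset _⟩ β fun ω _ w => hβnn ω w)
        -- identify `𝔼_w β_ω(w)` with the box power over `A`
        have h4 : ∀ ω, (𝔼 y, β ω y) = boxPower (insert α A') (f' ω) := fun ω => by
          rw [boxPower_insert hα]
          rfl
        simp_rw [h4, hmcard, one_div] at h3
        have h5 := pow_le_pow_left₀ (expect_doubledFamily_nonneg A' α f') h3 m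
        rw [← Finset.prod_pow] at h5
        refine h5.trans (le_of_eq (Finset.prod_congr rfl fun ω _ => ?_))
        exact Real.rpow_inv_natCast_pow
          (boxPower_nonneg (Finset.insert_nonempty α A') _) hm0
    -- combine the two factors
    have hT := expect_boxProd_insert_sq_le hα f
    rw [Finset.card_insert_of_notMem hα, pow_succ', pow_mul, sq_abs,
      Finset.prod_powerset_insert hα]
    refine (pow_le_pow_left₀ (sq_nonneg _) hT _).trans ?_
    rw [mul_pow]
    exact mul_le_mul (hE f) (hE fun ω => f (insert α ω)) (pow_nonneg
      (expect_doubledFamily_nonneg A' α _) _)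
      ((pow_nonneg (expect_doubledFamily_nonneg A' α f) _).trans (hE f))

/-- The Gowers–Cauchy–Schwarz inequality with roots: `|𝔼 ∏_{ω ⊆ A} f_ω(x^{(ω)})| ≤
∏_{ω ⊆ A} ‖f_ω‖_{□^A}` where `‖g‖_{□^A} = (‖g‖_{□^A}^{2^{|A|}})^{1/2^{|A|}}`.
[cite: GreenTao2010, App. B, Lemma B.2] -/
theorem gowersCauchySchwarz_rpow {A : Finset ι} (hA : A.Nonempty)
    (f : Finset ι → (ι → X) → ℝ) :
    |(𝔼 y, boxProd A f y)| ≤ ∏ ω ∈ A.powerset, boxPower A (f ω) ^ ((2 ^ A.card : ℕ) : ℝ)⁻¹ := by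
  have hm0 : (2 ^ A.card : ℕ) ≠ 0 := by positivity
  rw [Real.finsetProd_rpow _ _ fun ω _ => boxPower_nonneg hA _,
    ← Real.pow_rpow_inv_natCast (abs_nonneg ((𝔼 y, boxProd A f y))) hm0]
  exact Real.rpow_le_rpow (pow_nonneg (abs_nonneg _) _) (gowersCauchySchwarz hA f)
    (by positivity)

end gcs


section weighted

variable {ι : Type*} [DecidableEq ι] {X : Type*}

/-- A function of the coordinates in `C ⊆ A` and of the undoubled coordinates takes the same
value at `x^{(ω)}` and at `x^{(ω ∩ C)}`, `ω ⊆ A`. [folklore] -/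
theorem mixPt_inter_of_dependsOn {A C ω : Finset ι} {g : (ι → X) → ℝ}
    (hg : DependsOn g ((↑C : Set ι) ∪ (↑A : Set ι)ᶜ)) (hω : ω ⊆ A) (x₀ x₁ : ι → X) :
    g (mixPt x₀ x₁ ω) = g (mixPt x₀ x₁ (ω ∩ C)) := by
  refine hg fun a ha => ?_
  rcases ha with ha | ha
  · exact (mixPt_inter_eq_of_mem (Finset.mem_coe.mp ha)).symm
  · have haA : a ∉ A := fun h => ha (Finset.mem_coe.mpr h)
    have h1 : a ∉ ω := fun h => haA (hω h)
    have h2 : a ∉ ω ∩ C := fun h => h1 (Finset.mem_inter.mp h).1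
    rw [mixPt_of_not_mem h1, mixPt_of_not_mem h2]

/-- A function of the coordinates in `B ⊆ A` and of the undoubled coordinates takes the same
value at `x^{(B)}` and at `x^{(A)}`. [folklore] -/
theorem mixPt_self_of_dependsOn {A B : Finset ι} {g : (ι → X) → ℝ}
    (hg : DependsOn g ((↑B : Set ι) ∪ (↑A : Set ι)ᶜ)) (hB : B ⊆ A) (x₀ x₁ : ι → X) :
    g (mixPt x₀ x₁ B) = g (mixPt x₀ x₁ A) := by
  refine hg fun a ha => ?_
  rcases ha with ha | ha
  · rw [mixPt_of_mem (Finset.mem_coe.mp ha), mixPt_of_mem (hB (Finset.mem_coe.mp ha))]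
  · have haA : a ∉ A := fun h => ha (Finset.mem_coe.mpr h)
    rw [mixPt_of_not_mem haA, mixPt_of_not_mem fun h => haA (hB h)]

/-- Counting the vertices of `{0,1}^A` above a vertex of `{0,1}^C`:
`∏_{ω ⊆ A} F(ω ∩ C) = ∏_{ω' ⊆ C} F(ω')^{2^{|A ∖ C|}}` for `C ⊆ A`. [folklore] -/
theorem prod_powerset_inter {A C : Finset ι} (hC : C ⊆ A) (F : Finset ι → ℝ) :
    ∏ ω ∈ A.powerset, F (ω ∩ C) = ∏ ω' ∈ C.powerset, F ω' ^ (2 ^ (A \ C).card) := by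
  have hrhs : ∏ ω' ∈ C.powerset, F ω' ^ (2 ^ (A \ C).card) =
      ∏ q ∈ C.powerset ×ˢ (A \ C).powerset, F q.1 := by
    rw [Finset.prod_product]
    refine Finset.prod_congr rfl fun ω' _ => ?_
    simp [Finset.prod_const, Finset.card_powerset]
  rw [hrhs]
  refine Finset.prod_nbij' (fun ω => (ω ∩ C, ω \ C)) (fun q => q.1 ∪ q.2) ?_ ?_ ?_ ?_ ?_
  · intro ω hω
    have hω' : ω ⊆ A := Finset.mem_powerset.mp hω
    simp only [Finset.mem_product, Finset.mem_powerset]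
    exact ⟨Finset.inter_subset_right, Finset.sdiff_subset_sdiff hω' le_rfl⟩
  · intro q hq
    simp only [Finset.mem_product, Finset.mem_powerset] at hq ⊢
    exact Finset.union_subset (hq.1.trans hC) (hq.2.trans Finset.sdiff_subset)
  · intro ω _
    ext a
    by_cases h : a ∈ C <;> simp [h]
  · intro q hq
    simp only [Finset.mem_product, Finset.mem_powerset] at hq
    have hdisj : ∀ a, a ∈ q.2 → a ∉ C := fun a ha h => (Finset.mem_sdiff.mp (hq.2 ha)).2 h
    ext a
    · simp only [Finset.mem_inter, Finset.mem_union]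
      constructor
      · rintro ⟨h1 | h1, h2⟩
        · exact h1
        · exact absurd h2 (hdisj a h1)
      · intro h
        exact ⟨Or.inl h, hq.1 h⟩
    · simp only [Finset.mem_sdiff, Finset.mem_union]
      constructor
      · rintro ⟨h1 | h1, h2⟩
        · exact absurd (hq.1 h1) h2
        · exact h1
      · intro h
        exact ⟨Or.inr h, hdisj a h⟩
  · intro ω _
    rfl

/-- Counting the vertices of `{0,1}^A` above `C`: `#{B ⊆ A : C ⊆ B} = 2^{|A ∖ C|}` (Mathlib's
`Finset.card_Icc_finset`). [folklore] -/
theorem card_filter_superset {A C : Finset ι} (hC : C ⊆ A) :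
    (A.powerset.filter fun B => C ⊆ B).card = 2 ^ (A \ C).card := by
  rw [← Finset.Icc_eq_filter_powerset, Finset.card_Icc_finset hC, Finset.card_sdiff_of_subset hC]

/-- Exchanging a double product over `C ⊆ B ⊆ A`. [folklore] -/
theorem prod_powerset_powerset_comm (A : Finset ι) (h : Finset ι → Finset ι → ℝ) :
    ∏ B ∈ A.powerset, ∏ C ∈ B.powerset, h B C =
      ∏ C ∈ A.powerset, ∏ B ∈ A.powerset.filter (fun B => C ⊆ B), h B C := by
  refine Finset.prod_comm' fun B C => ?_
  simp only [Finset.mem_powerset, Finset.mem_filter]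
  constructor
  · rintro ⟨hBA, hCB⟩
    exact ⟨⟨hBA, hCB⟩, hCB.trans hBA⟩
  · rintro ⟨⟨hBA, hCB⟩, _⟩
    exact ⟨hBA, hCB⟩

/-- Swapping the `A`-coordinates of a pair is an involution. [folklore] -/
theorem mixPt_mixPt_swap (A : Finset ι) (x₀ x₁ : ι → X) :
    mixPt (mixPt x₀ x₁ A) (mixPt x₁ x₀ A) A = x₀ := by
  funext a
  by_cases h : a ∈ A <;> simp [mixPt, h]

/-- The pair map `(x⁽⁰⁾, x⁽¹⁾) ↦ (x^{(A)}, x̃^{(A)})` (swap the `A`-coordinates) as a permutation.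
[folklore] -/
def swapPairs (A : Finset ι) : ((ι → X) × (ι → X)) ≃ ((ι → X) × (ι → X)) :=
  Function.Involutive.toPerm (fun p => (mixPt p.1 p.2 A, mixPt p.2 p.1 A)) fun p => by
    ext1
    · exact mixPt_mixPt_swap A p.1 p.2
    · exact mixPt_mixPt_swap A p.2 p.1

variable [Fintype ι] [Fintype X] [Nonempty X]

/-- `𝔼_{x⁽⁰⁾,x⁽¹⁾} G(x^{(A)}) = 𝔼_x G(x)`. [folklore] -/
theorem expect_mixPt_self (A : Finset ι) (G : (ι → X) → ℝ) :
    (𝔼 p : (ι → X) × (ι → X), G (mixPt p.1 p.2 A)) = (𝔼 y, G y) := by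
  have h := expect_comp_equiv (swapPairs (X := X) A) (fun p : (ι → X) × (ι → X) => G p.1)
  rw [expect_prod_fst] at h
  exact h

/-- **Products of lower-order functions as box products** (the first step of the proof of
Cor. B.3): if each `f_B`, `B ⊆ A`, depends only on the coordinates in `B` and on the undoubled
coordinates, then `𝔼_x ∏_{B ⊆ A} f_B(x) = 𝔼 ∏_{B ⊆ A} f_B(x^{(B)})`.
[cite: GreenTao2010, App. B, proof of Cor. B.3] -/
theorem expect_prod_eq_expect_boxProd (A : Finset ι) (f : Finset ι → (ι → X) → ℝ)
    (hf : ∀ B, B ⊆ A → DependsOn (f B) ((↑B : Set ι) ∪ (↑A : Set ι)ᶜ)) :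
    (𝔼 x : ι → X, ∏ B ∈ A.powerset, f B x) = (𝔼 y, boxProd A f y) := by
  rw [← expect_mixPt_self A]
  congr 1; funext p
  unfold boxProd
  refine Finset.prod_congr rfl fun B hB => ?_
  exact (mixPt_self_of_dependsOn (hf B (Finset.mem_powerset.mp hB))
    (Finset.mem_powerset.mp hB) _ _).symm

/-- The weighted box power `‖g‖_{□^B(ν)}^{2^{|B|}} =
𝔼 (∏_{ω ⊆ B} g(x^{(ω)})) ∏_{C ⊊ B} ∏_{ω ⊆ C} ν_C(x^{(ω)})` of Cor. B.4 (real-valued; undoubled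
coordinates averaged as well). [cite: GreenTao2010, App. B, Cor. B.4] -/
def wBoxPower (ν : Finset ι → (ι → X) → ℝ) (B : Finset ι) (g : (ι → X) → ℝ) : ℝ :=
  (𝔼 p : (ι → X) × (ι → X), (∏ ω ∈ B.powerset, g (mixPt p.1 p.2 ω)) *
    ∏ C ∈ B.ssubsets, ∏ ω ∈ C.powerset, ν C (mixPt p.1 p.2 ω))

end weighted


section weightedMain

variable {ι : Type*} [DecidableEq ι] [Fintype ι] {X : Type*} [Fintype X] [Nonempty X]

/-- `(y^{1/2^{a-c}})^{2^{a-b}} = y^{1/2^{b-c}}` for `c ≤ b ≤ a`. [folklore] -/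
theorem rpow_inv_two_pow_pow {y : ℝ} (hy : 0 ≤ y) {a b c : ℕ} (hcb : c ≤ b) (hba : b ≤ a) :
    (y ^ ((2 ^ (a - c) : ℕ) : ℝ)⁻¹) ^ (2 ^ (a - b)) = y ^ ((2 ^ (b - c) : ℕ) : ℝ)⁻¹ := by
  rw [← Real.rpow_mul_natCast hy]
  congr 1
  have h : a - c = (a - b) + (b - c) := by omega
  rw [h, pow_add]
  push_cast
  have h1 : (2 : ℝ) ^ (a - b) ≠ 0 := by positivity
  have h2 : (2 : ℝ) ^ (b - c) ≠ 0 := by positivity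
  field_simp

/-- **Weighted generalised von Neumann inequality** (Green–Tao 2010, Cor. B.4, real-valued, in
`2^{|A|}`-th power form), for strictly positive weights: if `|f_B| ≤ ν_B` pointwise and each
`f_B, ν_B` depends only on the coordinates in `B` and the undoubled ones, then
`|𝔼_x ∏_{B ⊆ A} f_B(x)|^{2^{|A|}} ≤ ‖f_A‖_{□^A(ν)}^{2^{|A|}} ∏_{B ⊊ A} ‖ν_B‖_{□^B(ν)}^{2^{|B|}}`.
[cite: GreenTao2010, App. B, Cor. B.4] -/
theorem weightedGvN_of_pos {A : Finset ι} (hA : A.Nonempty) (f ν : Finset ι → (ι → X) → ℝ)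
    (hf : ∀ B, B ⊆ A → DependsOn (f B) ((↑B : Set ι) ∪ (↑A : Set ι)ᶜ))
    (hν : ∀ B, B ⊆ A → DependsOn (ν B) ((↑B : Set ι) ∪ (↑A : Set ι)ᶜ))
    (hpos : ∀ B, B ⊆ A → ∀ x, 0 < ν B x) (hdom : ∀ B, B ⊆ A → ∀ x, |f B x| ≤ ν B x) :
    |(𝔼 x : ι → X, ∏ B ∈ A.powerset, f B x)| ^ (2 ^ A.card) ≤
      wBoxPower ν A (f A) * ∏ B ∈ A.ssubsets, wBoxPower ν B (ν B) := by
  -- exponents `E C = 2^{-(|A|-|C|)}`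
  set E : Finset ι → ℝ := fun C => ((2 ^ (A.card - C.card) : ℕ) : ℝ)⁻¹ with hE
  have hEA : E A = 1 := by simp [hE]
  -- the modified functions `f̃_B`
  set ft : Finset ι → (ι → X) → ℝ :=
    fun B x => f B x / ν B x * ∏ C ∈ B.powerset, ν C x ^ E C with hft
  have hνnn : ∀ B, B ⊆ A → ∀ x, 0 ≤ ν B x := fun B hB x => (hpos B hB x).le
  -- the key telescoping identity `∏_{B ⊆ A'} ∏_{C ⊆ B} ν_C^{E C} = ∏_{C ⊆ A'} ν_C^{E_C 2^{|A'∖C|}}`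
  have hkey : ∀ (A' : Finset ι) (G : Finset ι → ℝ),
      ∏ B ∈ A'.powerset, ∏ C ∈ B.powerset, G C ^ E C =
        ∏ C ∈ A'.powerset, (G C ^ E C) ^ (2 ^ (A' \ C).card) := by
    intro A' G
    rw [prod_powerset_powerset_comm]
    refine Finset.prod_congr rfl fun C hC => ?_
    rw [Finset.prod_const, card_filter_superset (Finset.mem_powerset.mp hC)]
  -- (i) `∏_B f̃_B = ∏_B f_B`
  have htel : ∀ x, ∏ B ∈ A.powerset, ft B x = ∏ B ∈ A.powerset, f B x := by
    intro x
    simp only [hft]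
    rw [Finset.prod_mul_distrib, hkey A (fun C => ν C x)]
    have h1 : ∀ C ∈ A.powerset, (ν C x ^ E C) ^ (2 ^ (A \ C).card) = ν C x := by
      intro C hC
      rw [Finset.card_sdiff_of_subset (Finset.mem_powerset.mp hC), hE]
      exact Real.rpow_inv_natCast_pow (hνnn C (Finset.mem_powerset.mp hC) x) (by positivity)
    rw [Finset.prod_congr rfl h1, ← Finset.prod_mul_distrib]
    refine Finset.prod_congr rfl fun B hB => ?_
    rw [div_mul_cancel₀ _ (hpos B (Finset.mem_powerset.mp hB) x).ne']
  -- (ii) `f̃_B` depends only on `B` and the undoubled coordinates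
  have hftdep : ∀ B, B ⊆ A → DependsOn (ft B) ((↑B : Set ι) ∪ (↑A : Set ι)ᶜ) := by
    intro B hB x y hxy
    simp only [hft]
    have hres : ∀ C, C ⊆ B → ∀ i ∈ (↑C : Set ι) ∪ (↑A : Set ι)ᶜ, x i = y i := by
      intro C hC i hi
      refine hxy i ?_
      rcases hi with hi | hi
      · exact Or.inl (hC (Finset.mem_coe.mp hi))
      · exact Or.inr hi
    rw [hf B hB hxy, hν B hB hxy]
    congr 1
    exact Finset.prod_congr rfl fun C hC => by rw [hν C ((Finset.mem_powerset.mp hC).trans hB)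
      (hres C (Finset.mem_powerset.mp hC))]
  -- (iii) Gowers–Cauchy–Schwarz for the family `f̃`
  have hgcs := gowersCauchySchwarz hA ft
  rw [← expect_prod_eq_expect_boxProd A ft hftdep] at hgcs
  simp_rw [htel] at hgcs
  -- (iv) the top term
  have htop : boxPower A (ft A) = wBoxPower ν A (f A) := by
    unfold boxPower wBoxPower boxProd
    congr 1; funext p
    simp only [hft]
    rw [Finset.prod_mul_distrib]
    simp_rw [div_eq_mul_inv]
    rw [Finset.prod_mul_distrib, mul_assoc]
    congr 1
    -- `∏_ω (ν_A^{-1} ∏_{C ⊆ A} ν_C^{E C}) = ∏_{C ⊊ A} ∏_{ω ⊆ C} ν_C`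
    have h1 : ∀ y : ι → X, (ν A y)⁻¹ * ∏ C ∈ A.powerset, ν C y ^ E C =
        ∏ C ∈ A.powerset.erase A, ν C y ^ E C := by
      intro y
      rw [← Finset.mul_prod_erase _ _ (Finset.mem_powerset_self A), hEA, Real.rpow_one,
        ← mul_assoc, inv_mul_cancel₀ (hpos A (Finset.Subset.refl A) y).ne', one_mul]
    rw [← Finset.prod_mul_distrib]
    simp_rw [h1]
    rw [Finset.prod_comm]
    refine Finset.prod_congr rfl fun C hC => ?_
    have hCA : C ⊆ A := Finset.mem_powerset.mp (Finset.mem_of_mem_erase hC)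
    calc ∏ ω ∈ A.powerset, ν C (mixPt p.1 p.2 ω) ^ E C
        = ∏ ω ∈ A.powerset, ν C (mixPt p.1 p.2 (ω ∩ C)) ^ E C :=
          Finset.prod_congr rfl fun ω hω => by
            rw [mixPt_inter_of_dependsOn (hν C hCA) (Finset.mem_powerset.mp hω)]
      _ = ∏ ω' ∈ C.powerset, (ν C (mixPt p.1 p.2 ω') ^ E C) ^ (2 ^ (A \ C).card) :=
          prod_powerset_inter hCA (fun ω' => ν C (mixPt p.1 p.2 ω') ^ E C)
      _ = ∏ ω' ∈ C.powerset, ν C (mixPt p.1 p.2 ω') :=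
          Finset.prod_congr rfl fun ω' _ => by
            rw [Finset.card_sdiff_of_subset hCA, hE]
            exact Real.rpow_inv_natCast_pow (hνnn C hCA _) (by positivity)
  -- (v) the lower-order terms
  have hlow : ∀ B ∈ A.powerset.erase A, boxPower A (ft B) ≤ wBoxPower ν B (ν B) := by
    intro B hB
    have hBA : B ⊆ A := Finset.mem_powerset.mp (Finset.mem_of_mem_erase hB)
    have hBne : B ≠ A := Finset.ne_of_mem_erase hB
    have hk : 1 ≤ (A \ B).card := by
      rw [Nat.one_le_iff_ne_zero, Ne, Finset.card_eq_zero, Finset.sdiff_eq_empty_iff_subset]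
      exact fun h => hBne (Finset.Subset.antisymm hBA h)
    set M : ℕ := 2 ^ (A \ B).card with hM
    have hMeven : Even M := by
      rw [hM, Nat.even_pow]
      exact ⟨even_two, by omega⟩
    -- exponents inside `B`
    set E' : Finset ι → ℝ := fun C => ((2 ^ (B.card - C.card) : ℕ) : ℝ)⁻¹ with hE'
    have hE'B : E' B = 1 := by simp [hE']
    -- pointwise bound `f̃_B^M ≤ ∏_{C ⊆ B} ν_C^{E' C}`
    have hpt : ∀ y : ι → X, 0 ≤ ft B y ^ M ∧ ft B y ^ M ≤ ∏ C ∈ B.powerset, ν C y ^ E' C := by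
      intro y
      refine ⟨hMeven.pow_nonneg _, ?_⟩
      have habs : |ft B y| ≤ ∏ C ∈ B.powerset, ν C y ^ E C := by
        simp only [hft]
        rw [abs_mul, abs_div, abs_of_pos (hpos B hBA y),
          abs_of_nonneg (Finset.prod_nonneg fun C hC =>
            Real.rpow_nonneg (hνnn C ((Finset.mem_powerset.mp hC).trans hBA) y) _)]
        calc |f B y| / ν B y * ∏ C ∈ B.powerset, ν C y ^ E C
            ≤ 1 * ∏ C ∈ B.powerset, ν C y ^ E C := by
              gcongr
              · exact Finset.prod_nonneg fun C hC =>
                  Real.rpow_nonneg (hνnn C ((Finset.mem_powerset.mp hC).trans hBA) y) _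
              · rw [div_le_one (hpos B hBA y)]
                exact hdom B hBA y
          _ = _ := one_mul _
      rw [← hMeven.pow_abs]
      refine (pow_le_pow_left₀ (abs_nonneg _) habs M).trans (le_of_eq ?_)
      rw [← Finset.prod_pow]
      refine Finset.prod_congr rfl fun C hC => ?_
      rw [hE, hM, Finset.card_sdiff_of_subset hBA, hE']
      exact rpow_inv_two_pow_pow (hνnn C ((Finset.mem_powerset.mp hC).trans hBA) y)
        (Finset.card_le_card (Finset.mem_powerset.mp hC)) (Finset.card_le_card hBA)
    -- rewrite the box power over `A` as one over `B`
    have hbp : boxPower A (ft B) =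
        (𝔼 p : (ι → X) × (ι → X), ∏ ω' ∈ B.powerset, ft B (mixPt p.1 p.2 ω') ^ M) := by
      unfold boxPower boxProd
      congr 1; funext p
      rw [← prod_powerset_inter hBA (fun ω' => ft B (mixPt p.1 p.2 ω'))]
      exact Finset.prod_congr rfl fun ω hω =>
        mixPt_inter_of_dependsOn (hftdep B hBA) (Finset.mem_powerset.mp hω) _ _
    rw [hbp]
    unfold wBoxPower
    refine Finset.expect_le_expect fun p _ => ?_
    calc ∏ ω' ∈ B.powerset, ft B (mixPt p.1 p.2 ω') ^ M
        ≤ ∏ ω' ∈ B.powerset, ∏ C ∈ B.powerset, ν C (mixPt p.1 p.2 ω') ^ E' C :=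
          Finset.prod_le_prod (fun ω' _ => (hpt _).1) fun ω' _ => (hpt _).2
      _ = ∏ C ∈ B.powerset, ∏ ω' ∈ B.powerset, ν C (mixPt p.1 p.2 (ω' ∩ C)) ^ E' C := by
          rw [Finset.prod_comm]
          refine Finset.prod_congr rfl fun C hC => Finset.prod_congr rfl fun ω' hω' => ?_
          rw [mixPt_inter_of_dependsOn (hν C ((Finset.mem_powerset.mp hC).trans hBA))
            ((Finset.mem_powerset.mp hω').trans hBA)]
      _ = ∏ C ∈ B.powerset, ∏ ω'' ∈ C.powerset, ν C (mixPt p.1 p.2 ω'') := by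
          refine Finset.prod_congr rfl fun C hC => ?_
          have hCB : C ⊆ B := Finset.mem_powerset.mp hC
          rw [prod_powerset_inter hCB (fun ω' => ν C (mixPt p.1 p.2 ω') ^ E' C)]
          refine Finset.prod_congr rfl fun ω'' _ => ?_
          rw [Finset.card_sdiff_of_subset hCB, hE']
          exact Real.rpow_inv_natCast_pow (hνnn C (hCB.trans hBA) _) (by positivity)
      _ = (∏ ω'' ∈ B.powerset, ν B (mixPt p.1 p.2 ω'')) *
            ∏ C ∈ B.ssubsets, ∏ ω'' ∈ C.powerset, ν C (mixPt p.1 p.2 ω'') :=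
          (Finset.mul_prod_erase _ _ (Finset.mem_powerset_self B)).symm
  -- (vi) assemble
  have htop0 : 0 ≤ wBoxPower ν A (f A) := htop ▸ boxPower_nonneg hA _
  calc |(𝔼 x : ι → X, ∏ B ∈ A.powerset, f B x)| ^ (2 ^ A.card)
      ≤ ∏ ω ∈ A.powerset, boxPower A (ft ω) := hgcs
    _ = boxPower A (ft A) * ∏ B ∈ A.powerset.erase A, boxPower A (ft B) :=
        (Finset.mul_prod_erase _ _ (Finset.mem_powerset_self A)).symm
    _ ≤ wBoxPower ν A (f A) * ∏ B ∈ A.ssubsets, wBoxPower ν B (ν B) := by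
        rw [htop]
        refine mul_le_mul_of_nonneg_left ?_ htop0
        exact Finset.prod_le_prod (fun B _ => boxPower_nonneg hA _) hlow

end weightedMain


section weightedLimit

variable {ι : Type*} [DecidableEq ι] [Fintype ι] {X : Type*} [Fintype X]

/-- The weighted box power depends continuously on a constant added to all weights. [folklore] -/
theorem continuous_wBoxPower_add (ν : Finset ι → (ι → X) → ℝ) (B : Finset ι)
    (g : ℝ → (ι → X) → ℝ) (hg : ∀ x, Continuous fun ε => g ε x) :
    Continuous fun ε : ℝ => wBoxPower (fun C x => ν C x + ε) B (g ε) := by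
  unfold wBoxPower
  simp only [Fintype.expect_eq_sum_div_card]
  fun_prop

variable [Nonempty X]

/-- **Weighted generalised von Neumann inequality** (Green–Tao 2010, Cor. B.4, real-valued, in
`2^{|A|}`-th power form): if `|f_B| ≤ ν_B` pointwise (`ν_B ≥ 0`) and each `f_B, ν_B` depends
only on the coordinates in `B` and the undoubled ones, then
`|𝔼_x ∏_{B ⊆ A} f_B(x)|^{2^{|A|}} ≤ ‖f_A‖_{□^A(ν)}^{2^{|A|}} ∏_{B ⊊ A} ‖ν_B‖_{□^B(ν)}^{2^{|B|}}`
("By a limiting argument we may assume that the `ν_B` are strictly positive").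
[cite: GreenTao2010, App. B, Cor. B.4] -/
theorem weightedGvN {A : Finset ι} (hA : A.Nonempty) (f ν : Finset ι → (ι → X) → ℝ)
    (hf : ∀ B, B ⊆ A → DependsOn (f B) ((↑B : Set ι) ∪ (↑A : Set ι)ᶜ))
    (hν : ∀ B, B ⊆ A → DependsOn (ν B) ((↑B : Set ι) ∪ (↑A : Set ι)ᶜ))
    (hνnn : ∀ B, B ⊆ A → ∀ x, 0 ≤ ν B x) (hdom : ∀ B, B ⊆ A → ∀ x, |f B x| ≤ ν B x) :
    |(𝔼 x : ι → X, ∏ B ∈ A.powerset, f B x)| ^ (2 ^ A.card) ≤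
      wBoxPower ν A (f A) * ∏ B ∈ A.ssubsets, wBoxPower ν B (ν B) := by
  -- the perturbed weights
  set W : ℝ → ℝ := fun ε => wBoxPower (fun C x => ν C x + ε) A (f A) *
    ∏ B ∈ A.ssubsets, wBoxPower (fun C x => ν C x + ε) B (fun x => ν B x + ε) with hW
  have hWε : ∀ ε : ℝ, 0 < ε →
      |(𝔼 x : ι → X, ∏ B ∈ A.powerset, f B x)| ^ (2 ^ A.card) ≤ W ε := by
    intro ε hε
    refine weightedGvN_of_pos hA f (fun C x => ν C x + ε) hf ?_ (fun B hB x => by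
      linarith [hνnn B hB x]) fun B hB x => (hdom B hB x).trans (by linarith)
    intro B hB x y hxy
    simp only [hν B hB hxy]
  have hcont : Continuous W := by
    simp only [hW]
    refine (continuous_wBoxPower_add ν A (fun _ => f A) fun x => continuous_const).mul ?_
    refine continuous_finsetProd _ fun B _ => ?_
    exact continuous_wBoxPower_add ν B (fun ε x => ν B x + ε) fun x => by fun_prop
  have hlim : Filter.Tendsto W (nhdsWithin 0 (Set.Ioi 0)) (nhds (W 0)) :=
    (hcont.tendsto 0).mono_left nhdsWithin_le_nhds
  have h0 : W 0 = wBoxPower ν A (f A) * ∏ B ∈ A.ssubsets, wBoxPower ν B (ν B) := by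
    simp only [hW, add_zero]
  rw [← h0]
  exact ge_of_tendsto hlim (eventually_nhdsWithin_of_forall fun ε hε => hWε ε hε)

end weightedLimit

end Literature.NumberTheory.Sieve
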